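/-
Copyright (c) 2026 the pub-hodgecm-mathlib formalisation cell (harness21).  Prover seat hodgecm-mathlib-K2E1-p08 (g5), Track B ∕ K2-LIT, h413 =
`stmt-HodgeConjecture-24833`, campaign «EIS-RANK-ONE» (q5) [D5]₃ SPHERICAL, file (a1ᵘ): the one-variable symbol estimate UNIFORM in the curvature constant, and its affine
edition `(A + c s²)^{−z}` (dealer K2E1-plan (g4) 2026-09-04T06:47:48Z; announced 06:50Z).
-/
import Summits.HodgeConjecture.HodgeConjecture.Theorems.K2E1OnePlusSqPowerSymbol     -- ★ (a1) p857934 (this seat): `(1 + c s²)^{−z}` is a symbol, per `c`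
import HarnessLib

/-!
# K2·E1 — `K2E1OnePlusSqPowerSymbolUniform` ((q5) [D5]₃ file (a1ᵘ)): `‖Dⁿ[(A + c s²)^{−z}]‖ ≤ C·(A + c s²)^{−Re z}` with ONE `C = C(c₀, z, n)` for ALL `A ≥ 1`, `0 < c ≤ c₀`

Track B ∕ K2-LIT, crux h413 = `stmt-HodgeConjecture-24833`, route of record `HCCMUnconditional`; cell `hodgecm-mathlib`, squad K2, ENGINE E1, campaign EIS-RANK-ONE, queue item (q5)
[D5]₃.  Prover seat `hodgecm-mathlib-K2E1-p08` (g5).  THEOREMS ONLY (no `def`, no `instance`, no notation, no named-fact hypothesis, no `sorry`); lane `--kind proof --supports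
stmt-HodgeConjecture-24833 --as helper` (count-neutral).  Pure calculus over Mathlib + ★ (a1).

WHY.  Along the big-cell Heisenberg line of `U(2,1)` the archimedean factor at a complex place `w` is the positive quadratic `A_w + c_w s²` in the centre variable with
`A_w = (1 + ½‖X_w‖²)² ≥ 1` depending on the shift `X` (★ (a2)₃ `K2E1HeightBigCellLineFormulaU3`), and the centre-layer binder of ★ p857895 must hold with ONE constant for ALL `X`.
★ (a1) gives `∃ C` per curvature `c`; here:
* §1 SCALING `F_{c₀a²}(s) = F_{c₀}(a s)` (`F_c(s) = (1 + c s²)^{−z}`), so `F_{c₀a²}⁽ⁿ⁾(s) = aⁿ·F_{c₀}⁽ⁿ⁾(a s)` (Mathlib `iteratedDeriv_comp_const_smul`) and, for `0 < c ≤ c₀` (`a = √(c/c₀) ≤ 1`),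
  **`exists_norm_iteratedDeriv_le_uniform`**: `∃ C ≥ 0, ∀ c ∈ (0, c₀], ∀ s, ‖F_c⁽ⁿ⁾(s)‖ ≤ C·(1 + c s²)^{−Re z}`.
* §2 THE AFFINE EDITION `(A + c s²)^{−z} = A^{−z}·F_{c/A}(s)` (`A ≥ 1 ⟹ c/A ≤ c`): **`exists_norm_iteratedDeriv_affine_le_uniform`**:
  `∃ C ≥ 0, ∀ A ≥ 1, ∀ c ∈ (0, c₀], ∀ s, ‖Dⁿ[(A + c s²)^{−z}](s)‖ ≤ C·(A + c s²)^{−Re z}`, with `contDiff_affinePow`, `norm_affinePow`.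
[Hörmander ALPDO I §7.1 (dilations of symbols).]

HONEST LABEL: HC_CM is proved only modulo the 7 printed citations (2 remaining named inputs: hLiu418 = `stmt-HodgeConjecture-24832`, h413 = `stmt-HodgeConjecture-24833`) until
rung 0 closes; count-neutral helper, closes no socket.  (The `z`-uniform edition on compacts asked by K2E1-p09 (g5) is NOT in this file.)

## References
* [HormanderALPDO1] L. Hörmander, *The Analysis of Linear Partial Differential Operators I* (1983), §7.1.
* [MoeglinWaldspurger1995] C. Mœglin, J.-L. Waldspurger, *Spectral Decomposition and Eisenstein Series* (1995), I.2.10–I.2.12.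
-/

set_option autoImplicit false
-- the mandated namespace repeats the single-problem summit's segment (`HodgeConjecture.HodgeConjecture`)
set_option linter.dupNamespace false

noncomputable section

open Real Complex
open scoped ContDiff
open Summit.HodgeConjecture.HodgeConjecture.Cruxes.H413.K2E1OnePlusSqPowerSymbol

namespace Summit.HodgeConjecture.HodgeConjecture.Cruxes.H413.K2E1OnePlusSqPowerSymbolUniform

/-! ## §1 Scaling and the curvature-uniform constant -/

/-- **SCALING `F_{c₀a²} = F_{c₀} ∘ (a·)`** as functions. [cite: HormanderALPDO1, §7.1] -/
theorem onePlusSqPow_scale (c₀ a : ℝ) (z : ℂ) :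
    (fun s : ℝ => ((((1 + c₀ * a ^ 2 * s ^ 2 : ℝ)) : ℂ) ^ (-z))) = fun s : ℝ => ((((1 + c₀ * (a * s) ^ 2 : ℝ)) : ℂ) ^ (-z)) := by
  funext s
  rw [show c₀ * a ^ 2 * s ^ 2 = c₀ * (a * s) ^ 2 by ring]

/-- **`F_{c₀a²}⁽ⁿ⁾(s) = aⁿ·F_{c₀}⁽ⁿ⁾(a s)`** (Mathlib `iteratedDeriv_comp_const_smul`, ★ (a1) `contDiff_onePlusSqPow`). [cite: HormanderALPDO1, §7.1] -/
theorem iteratedDeriv_onePlusSqPow_scale {c₀ : ℝ} (hc₀ : 0 ≤ c₀) (a : ℝ) (z : ℂ) (n : ℕ) (s : ℝ) :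
    iteratedDeriv n (fun s : ℝ => ((((1 + c₀ * a ^ 2 * s ^ 2 : ℝ)) : ℂ) ^ (-z))) s =
      a ^ n • iteratedDeriv n (fun s : ℝ => ((((1 + c₀ * s ^ 2 : ℝ)) : ℂ) ^ (-z))) (a * s) := by
  rw [onePlusSqPow_scale, iteratedDeriv_comp_const_smul (f := fun s : ℝ => ((((1 + c₀ * s ^ 2 : ℝ)) : ℂ) ^ (-z))) (contDiff_onePlusSqPow hc₀ z) a]

/-- **THE CURVATURE-UNIFORM SYMBOL ESTIMATE**: for `c₀ > 0`, `z ∈ ℂ`, `n ∈ ℕ` there is ONE `C ≥ 0` with `‖F_c⁽ⁿ⁾(s)‖ ≤ C·(1 + c s²)^{−Re z}` for all `0 < c ≤ c₀` and all `s`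
(★ (a1) at `c₀`, scaled by `a = √(c/c₀) ≤ 1`). [cite: HormanderALPDO1, §7.1] [cite: MoeglinWaldspurger1995, I.2.10–I.2.12] -/
theorem exists_norm_iteratedDeriv_le_uniform {c₀ : ℝ} (hc₀ : 0 < c₀) (z : ℂ) (n : ℕ) :
    ∃ C : ℝ, 0 ≤ C ∧ ∀ c : ℝ, 0 < c → c ≤ c₀ → ∀ s : ℝ,
      ‖iteratedDeriv n (fun s : ℝ => ((((1 + c * s ^ 2 : ℝ)) : ℂ) ^ (-z))) s‖ ≤ C * (1 + c * s ^ 2) ^ (-z.re) := by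
  obtain ⟨C, hC0, hC⟩ := exists_norm_iteratedDeriv_le hc₀ z n
  refine ⟨C, hC0, fun c hc hcc₀ s => ?_⟩
  set a : ℝ := Real.sqrt (c / c₀) with ha_def
  have ha0 : 0 ≤ a := Real.sqrt_nonneg _
  have ha2 : c₀ * a ^ 2 = c := by
    rw [ha_def, Real.sq_sqrt (div_nonneg hc.le hc₀.le), mul_div_cancel₀ _ hc₀.ne']
  have ha1 : a ≤ 1 := by
    rw [ha_def, Real.sqrt_le_one]
    exact (div_le_one hc₀).2 hcc₀
  have hfun : (fun s : ℝ => ((((1 + c * s ^ 2 : ℝ)) : ℂ) ^ (-z))) = fun s : ℝ => ((((1 + c₀ * a ^ 2 * s ^ 2 : ℝ)) : ℂ) ^ (-z)) := by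
    rw [ha2]
  rw [hfun, iteratedDeriv_onePlusSqPow_scale hc₀.le a z n s, norm_smul, norm_pow, Real.norm_eq_abs, abs_of_nonneg ha0]
  calc a ^ n * ‖iteratedDeriv n (fun s : ℝ => ((((1 + c₀ * s ^ 2 : ℝ)) : ℂ) ^ (-z))) (a * s)‖
      ≤ 1 * (C * (1 + c₀ * (a * s) ^ 2) ^ (-z.re)) :=
        mul_le_mul (pow_le_one₀ ha0 ha1) (hC (a * s)) (norm_nonneg _) zero_le_one
    _ = C * (1 + c * s ^ 2) ^ (-z.re) := by rw [one_mul, ← ha2]; ring_nf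

/-! ## §2 The affine edition `(A + c s²)^{−z}`, uniform in `A ≥ 1` and `0 < c ≤ c₀` -/

/-- `0 < A + c s²` for `A > 0`, `c ≥ 0`. [folklore] -/
theorem affine_pos {A c : ℝ} (hA : 0 < A) (hc : 0 ≤ c) (s : ℝ) : 0 < A + c * s ^ 2 := by positivity

/-- **`(A + c s²)^{−z} = A^{−z} · (1 + (c/A) s²)^{−z}`** (positive real bases, principal branch). [folklore] -/
theorem affinePow_eq_mul {A c : ℝ} (hA : 0 < A) (hc : 0 ≤ c) (z : ℂ) (s : ℝ) :
    ((((A + c * s ^ 2 : ℝ)) : ℂ) ^ (-z)) = (((A : ℝ) : ℂ) ^ (-z)) * ((((1 + c / A * s ^ 2 : ℝ)) : ℂ) ^ (-z)) := by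
  rw [show A + c * s ^ 2 = A * (1 + c / A * s ^ 2) by field_simp, Complex.ofReal_mul,
    Complex.mul_cpow_ofReal_nonneg hA.le (onePlusSq_pos (div_nonneg hc hA.le) s).le]

/-- The same as functions of `s`. [folklore] -/
theorem affinePow_eq_const_mul {A c : ℝ} (hA : 0 < A) (hc : 0 ≤ c) (z : ℂ) :
    (fun s : ℝ => ((((A + c * s ^ 2 : ℝ)) : ℂ) ^ (-z))) = fun s : ℝ => (((A : ℝ) : ℂ) ^ (-z)) * ((((1 + c / A * s ^ 2 : ℝ)) : ℂ) ^ (-z)) :=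
  funext fun s => affinePow_eq_mul hA hc z s

/-- **`s ↦ (A + c s²)^{−z}` is smooth** (`A > 0`, `c ≥ 0`). [folklore] -/
theorem contDiff_affinePow {A c : ℝ} (hA : 0 < A) (hc : 0 ≤ c) (z : ℂ) {n : WithTop ℕ∞} :
    ContDiff ℝ n (fun s : ℝ => ((((A + c * s ^ 2 : ℝ)) : ℂ) ^ (-z))) := by
  rw [affinePow_eq_const_mul hA hc z]
  exact contDiff_const.mul (contDiff_onePlusSqPow (div_nonneg hc hA.le) z)

/-- **`‖(A + c s²)^{−z}‖ = (A + c s²)^{−Re z}`**. [folklore] -/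
theorem norm_affinePow {A c : ℝ} (hA : 0 < A) (hc : 0 ≤ c) (z : ℂ) (s : ℝ) :
    ‖((((A + c * s ^ 2 : ℝ)) : ℂ) ^ (-z))‖ = (A + c * s ^ 2) ^ (-z.re) := by
  rw [Complex.norm_cpow_eq_rpow_re_of_pos (affine_pos hA hc s), Complex.neg_re]

/-- `Dⁿ[(A + c s²)^{−z}](s) = A^{−z} · F_{c/A}⁽ⁿ⁾(s)`. [folklore] -/
theorem iteratedDeriv_affinePow {A c : ℝ} (hA : 0 < A) (hc : 0 ≤ c) (z : ℂ) (n : ℕ) (s : ℝ) :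
    iteratedDeriv n (fun s : ℝ => ((((A + c * s ^ 2 : ℝ)) : ℂ) ^ (-z))) s =
      (((A : ℝ) : ℂ) ^ (-z)) * iteratedDeriv n (fun s : ℝ => ((((1 + c / A * s ^ 2 : ℝ)) : ℂ) ^ (-z))) s := by
  rw [affinePow_eq_const_mul hA hc z, iteratedDeriv_const_mul_field]

/-- **THE AFFINE, DOUBLY UNIFORM SYMBOL ESTIMATE**: for `c₀ > 0`, `z ∈ ℂ`, `n ∈ ℕ` there is ONE `C ≥ 0` with `‖Dⁿ[(A + c s²)^{−z}](s)‖ ≤ C·(A + c s²)^{−Re z}` for ALL `A ≥ 1`,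
`0 < c ≤ c₀`, `s ∈ ℝ` (§1 at curvature `c/A ≤ c ≤ c₀`; `‖A^{−z}‖ = A^{−Re z}`).  The per-place input of the centre-layer binder of ★ p857895 for the spherical flat section of `U(2,1)`.
[cite: HormanderALPDO1, §7.1] [cite: MoeglinWaldspurger1995, I.2.10–I.2.12] -/
theorem exists_norm_iteratedDeriv_affine_le_uniform {c₀ : ℝ} (hc₀ : 0 < c₀) (z : ℂ) (n : ℕ) :
    ∃ C : ℝ, 0 ≤ C ∧ ∀ A : ℝ, 1 ≤ A → ∀ c : ℝ, 0 < c → c ≤ c₀ → ∀ s : ℝ,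
      ‖iteratedDeriv n (fun s : ℝ => ((((A + c * s ^ 2 : ℝ)) : ℂ) ^ (-z))) s‖ ≤ C * (A + c * s ^ 2) ^ (-z.re) := by
  obtain ⟨C, hC0, hC⟩ := exists_norm_iteratedDeriv_le_uniform hc₀ z n
  refine ⟨C, hC0, fun A hA c hc hcc₀ s => ?_⟩
  have hA0 : 0 < A := zero_lt_one.trans_le hA
  have hcA : 0 < c / A := div_pos hc hA0
  have hcA₀ : c / A ≤ c₀ := (div_le_self hc.le hA).trans hcc₀
  rw [iteratedDeriv_affinePow hA0 hc.le z n s, norm_mul, Complex.norm_cpow_eq_rpow_re_of_pos hA0, Complex.neg_re]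
  calc A ^ (-z.re) * ‖iteratedDeriv n (fun s : ℝ => ((((1 + c / A * s ^ 2 : ℝ)) : ℂ) ^ (-z))) s‖
      ≤ A ^ (-z.re) * (C * (1 + c / A * s ^ 2) ^ (-z.re)) := mul_le_mul_of_nonneg_left (hC (c / A) hcA hcA₀ s) (Real.rpow_nonneg hA0.le _)
    _ = C * (A * (1 + c / A * s ^ 2)) ^ (-z.re) := by rw [Real.mul_rpow hA0.le (onePlusSq_pos hcA.le s).le]; ring
    _ = C * (A + c * s ^ 2) ^ (-z.re) := by rw [show A * (1 + c / A * s ^ 2) = A + c * s ^ 2 by field_simp]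

/-- The `iteratedFDeriv` form of the affine uniform estimate. [cite: HormanderALPDO1, §7.1] -/
theorem exists_norm_iteratedFDeriv_affine_le_uniform {c₀ : ℝ} (hc₀ : 0 < c₀) (z : ℂ) (n : ℕ) :
    ∃ C : ℝ, 0 ≤ C ∧ ∀ A : ℝ, 1 ≤ A → ∀ c : ℝ, 0 < c → c ≤ c₀ → ∀ s : ℝ,
      ‖iteratedFDeriv ℝ n (fun s : ℝ => ((((A + c * s ^ 2 : ℝ)) : ℂ) ^ (-z))) s‖ ≤ C * (A + c * s ^ 2) ^ (-z.re) := by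
  obtain ⟨C, hC0, hC⟩ := exists_norm_iteratedDeriv_affine_le_uniform hc₀ z n
  exact ⟨C, hC0, fun A hA c hc hcc₀ s => by rw [norm_iteratedFDeriv_eq_norm_iteratedDeriv]; exact hC A hA c hc hcc₀ s⟩

end Summit.HodgeConjecture.HodgeConjecture.Cruxes.H413.K2E1OnePlusSqPowerSymbolUniform

end
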